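import Summits.BirchSwinnertonDyer.BirchSwinnertonDyer.Theorems.ByReductionTypeAtTwoSupersingularFlatRoadDoor
import Summits.BirchSwinnertonDyer.BirchSwinnertonDyer.Theorems.ByReductionTypeAtTwoSupersingularColemanRoadV6
import Literature.NumberTheory.EllipticCurves.CyclotomicZpExtensionLocalGeneratorProofs
import Literature.NumberTheory.EllipticCurves.EisensteinNewformLevelRaisingDictionaryProofs
import HarnessLib

/-!
# Route `ByReductionTypeAtTwo` (rung K4), crux `SupersingularRankZeroAtTwo` (item
# stmt-BirchSwinnertonDyer-19097): THE ♭ COLEMAN ROAD AT `2`, part 3 — the ∀-closed `a₂ = ±2` road stub and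
# the crux BY NAME from the seven stubs of line `signed_halves_two` v7 (seat `bsd-2adic-ss-1`, GEN 9; sequel
# of `…SupersingularFlatRoad{,Door}.lean`)

HONEST FRAMING (cell `bsd-2adic`, run/shared/lean/pub/bsd-2adic/, HUMAN RULINGS D-0036/D-0054/D-0074):
THEOREMS ONLY; every research input an explicit hypothesis; no definition, no named fact, no instance, no
`sorry`; nothing booked; BSD is NOT proved by any of this. PARTITION (D-0054): X5@2 good-supersingular,
`a₂ = ±2` sub-row (B1·O1; 549 rank-`0` classes) × `p = 2` — types-the-object-of; closes none.

## What this file proves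

v6 of the line (`SSColemanRoad.supersingularRankZeroAtTwo_of_line_colemanKatoV6`, p495102) consumes on
`a₂ = ±2` the two Miller halves THEMSELVES (`stub_traceTwoMillerHalves`, MATH-BOUND). Here the UPPER half on
`a₂ = ±2` is produced from ONE ∀-closed ♭-road stub `hFlat` — for every curve of the sub-row, every
cyclotomic datum matching the variable and the place `v ∋ 2`, THERE ARE local Coleman data `(g, c)` at `v`
(`g` a local lift of the generator) for which: the ♭ `Γ`-Euler characteristic at `2` (EC♭), the ♭
Coleman–Kato package at `2` (CK♭: F1♭ · F3♭ · F4rat · F4@(2) guarded by `TwoAdicSurjective W`) and, on a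
curve WITHOUT `2`-adic surjectivity, `μ(X^♭(E/ℚ_∞)) = 0` (μ♭) hold — in print these data are Sprung's Honda
system at `2` (J. Number Theory 132, Thm. 2.2 (2′)) with his Coleman maps at `2` (§§2–6), and EC♭ / CK♭ are
Sprung 2024 §5.2 / Sprung 2012 §7 + Kato 12.5 READ AT `2`; no Honda predicate at `2` is asserted.

* `traceTwoUpper_of_flatRoad` — PUB {modularity, GZK, Kato 12.4 (2), Kato 12.4 (1) ∘ (17.13.1)} + `hFlat` ⇒
  `MissingUpperBoundAt W 2` for every non-CM rank-`0` good-supersingular curve with `a₂ = ±2` (by cases on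
  `TwoAdicSurjective W`: `SSFlatRoad.flatUpper_two_of_flatColemanKato` or `…_of_mu`, then
  `SSFlatRoad.missingUpperBoundAt_two_of_flatUpper`; the cyclotomic datum, the place above `2`
  (`natCast_mem_asIdeal_primesEquiv_symm`) are supplied by tree theorems).
* `supersingularRankZeroAtTwo_of_line_flatRoad` — **the crux BY NAME from the seven v7 stubs**:
  `stub_pub` (= v6 `stub_ssPub ∧ stub_katoPub`), `stub_zeroSignedEulerChar`, `stub_zeroKobayashiLower`,
  `stub_zeroColemanKato` (v6), `stub_zeroMuPlusOfNonSurj` (v6), `stub_pmFlatRoad` (NEW, above),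
  `stub_pmMillerLower` (= the LOWER conjunct of v6's `stub_traceTwoMillerHalves`: Miller's lower half on
  `a₂ = ±2`, certificate-shaped per class exactly like the `a₂ = 0` descent half).

References: [Sprung2012] Thm. 2.2, §§2–6, Thm. 7.14, 7.16, Prop. 7.19, Main Conj. 7.21; [Sprung2024] §5.2
Lemmas 5.5–5.9; [Sprung2017] Cor. 4.11; [Kato2004Asterisque] Thm. 12.4–12.5; [Kobayashi2003] Thm. 1.2, 4.1,
§7; [BDKim2013] Cor. 3.15; [KuriharaOtsuki2006] p. 564; [Washington1997] §13.1; [Miller2011LMS] Def. 1.1.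
-/

set_option autoImplicit false
-- the Theorems namespace of this sub repeats the summit name by design (D-0017 nested layout)
set_option linter.dupNamespace false

noncomputable section

open scoped Classical MatrixGroups ModularForm NumberField
open NumberField IsDedekindDomain CongruenceSubgroup WeierstrassCurve Literature.NumberTheory.EllipticCurves
  Literature.NumberTheory.EllipticCurves.ModularForms Literature.NumberTheory.EllipticCurves.Sprung2017
  Literature.NumberTheory.EllipticCurves.Sprung2012
  Literature.NumberTheory.EllipticCurves.Rank1Residual Literature.NumberTheory.EllipticCurves.Rank1Residual.Typed
  Literature.NumberTheory.EllipticCurves.Kobayashi2003 Literature.NumberTheory.EllipticCurves.IwasawaDual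
  Literature.NumberTheory.GaloisRepresentations
  ZpExtension Summit.BirchSwinnertonDyer.Rank1Residual Summit.BirchSwinnertonDyer.Rank1Residual.Supersingular
  Summit.BirchSwinnertonDyer.Rank1Residual.X5.O1

namespace Summit.BirchSwinnertonDyer.BirchSwinnertonDyer.Theorems
namespace SSFlatRoad

/-- **The UPPER Miller half on the `a₂ = ±2` sub-row from the ∀-closed ♭-road stub.** PUB {`hPub` =
modularity ∧ GZK, `h124`, `hX0`} + `hFlat` (module docstring: for every curve / cyclotomic datum / place
`v ∋ 2` there are local Coleman data `(g, c)` with EC♭ ∧ CK♭ ∧ (¬`TwoAdicSurjective` → μ♭ = 0)) ⇒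
`MissingUpperBoundAt W 2` on every non-CM rank-`0` good-supersingular `W` with `a₂ = ±2`.
[cite: Sprung2012, Thm. 2.2 (2′) (p. 1487), Thm. 7.16 and Prop. 7.19 (pp. 1504–1505)]
[cite: Sprung2024, §5.2 Lemmas 5.5–5.9 (pp. 40–41)] [cite: Kato2004Asterisque, Thm. 12.4–12.5] [cite: Miller2011LMS, Def. 1.1] -/
theorem traceTwoUpper_of_flatRoad
    (hPub : nonempty_modularParametrizationData ∧ rank_eq_analyticRank_of_analyticRank_le_one)
    (h124 : Kato2004.thm12_4) (hX0 : Kato2004_fineSelmerDual_isTorsion)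
    (hFlat : ∀ (W : WeierstrassCurve ℚ) [W.IsElliptic] [W.IsGloballyMinimal],
      ¬ W.HasCM → W.analyticRank = 0 → GoodSS W 2 → (W.frobeniusTrace 2 = 2 ∨ W.frobeniusTrace 2 = -2) →
      ∀ (κ : ZpExtension ℚ 2) (γ : Field.absoluteGaloisGroup ℚ),
        κ.IsCyclotomic → κ.IsTopGenerator γ → IsCyclotomicVariable 2 γ →
      ∀ (v : HeightOneSpectrum (𝓞 ℚ)), (2 : 𝓞 ℚ) ∈ v.asIdeal →
      ∃ (g : Field.absoluteGaloisGroup (v.adicCompletion ℚ)) (c : ℕ → localPoints W (v.adicCompletion ℚ)),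
        κ.IsTopGenerator (resGalOfEmb (closureEmb (K := ℚ) (v.adicCompletion ℚ)) g) ∧
        (∀ (D : SharpFlatSelmerDualData W κ γ (closureEmb (K := ℚ) (v.adicCompletion ℚ))
            (W.frobeniusTrace 2) g c .flat) [Module.Finite (IwasawaAlgebra 2) D.X],
          Module.IsTorsion (IwasawaAlgebra 2) D.X →
          ∀ f : IwasawaAlgebra 2, D.charIdeal = Ideal.span {f} → Finite (W.selmerGroupPInfty 2) →
            ∃ u : ℤ_[2]ˣ, ((PowerSeries.constantCoeff f : ℤ_[2]) : ℚ_[2]) =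
              ((u : ℤ_[2]) : ℚ_[2]) * ((2 : ℕ) : ℚ_[2]) ^ (padicValNat 2 W.tamagawaProduct) *
                (Nat.card (W.selmerGroupPInfty 2) : ℚ_[2])) ∧
        (∀ [NeZero (W.conductorNorm ℤ)] (f : CuspForm (Gamma0 (W.conductorNorm ℤ)) 2),
            IsNewformOf W f → ∀ (ϖ : ℚ), (ϖ : ℝ) * W.realPeriodRat = plusPeriod f →
          ∀ (Ls Lf : IwasawaAlgebra 2), IsSprungPair f 2 (W.frobeniusTrace 2) Ls Lf →
          ∀ (D : SharpFlatSelmerDualData W κ γ (closureEmb (K := ℚ) (v.adicCompletion ℚ))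
              (W.frobeniusTrace 2) g c .flat) [ContinuousSMul ℤ_[2] (W.tateModule 2)],
            ∃ (I : Kato2004.IwasawaH1Data W 2 κ γ) (Y : W.FineSelmerDualData κ γ)
              (P : Submodule (IwasawaAlgebra 2) (IwasawaAlgebra 2))
              (loc : I.H →ₗ[IwasawaAlgebra 2] P) (toX : P →ₗ[IwasawaAlgebra 2] D.X)
              (δ : D.X →ₗ[IwasawaAlgebra 2] Y.X) (Z : Submodule (IwasawaAlgebra 2) I.H)
              (G : IwasawaAlgebra 2),
              Function.Exact loc toX ∧ Function.Exact toX δ ∧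
              G ∈ Submodule.map (P.subtype ∘ₗ loc) Z ∧
              iwasawaToPowerSeries 2 G = PowerSeries.C (ϖ : ℚ_[2]) * iwasawaToPowerSeries 2 Lf ∧
              (∀ 𝔭 : PrimeSpectrum (IwasawaAlgebra 2), 𝔭.asIdeal.height = 1 →
                PowerSeries.C (2 : ℤ_[2]) ∉ 𝔭.asIdeal →
                Literature.NumberTheory.EllipticCurves.Module.lengthAt (IwasawaAlgebra 2) Y.X 𝔭 ≤
                  Literature.NumberTheory.EllipticCurves.Module.lengthAt (IwasawaAlgebra 2) (I.H ⧸ Z) 𝔭) ∧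
              (TwoAdicSurjective W →
                ∀ 𝔭 : PrimeSpectrum (IwasawaAlgebra 2), 𝔭.asIdeal.height = 1 →
                  PowerSeries.C (2 : ℤ_[2]) ∈ 𝔭.asIdeal →
                  Literature.NumberTheory.EllipticCurves.Module.lengthAt (IwasawaAlgebra 2) Y.X 𝔭 ≤
                    Literature.NumberTheory.EllipticCurves.Module.lengthAt (IwasawaAlgebra 2) (I.H ⧸ Z) 𝔭)) ∧
        (¬ TwoAdicSurjective W →
          ∀ (D : SharpFlatSelmerDualData W κ γ (closureEmb (K := ℚ) (v.adicCompletion ℚ))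
              (W.frobeniusTrace 2) g c .flat) (g' : IwasawaAlgebra 2),
            D.charIdeal = Ideal.span {g'} → ¬ PowerSeries.C (2 : ℤ_[2]) ∣ g')) :
    ∀ (W : WeierstrassCurve ℚ) [W.IsElliptic] [W.IsGloballyMinimal],
      ¬ W.HasCM → W.analyticRank = 0 → GoodSS W 2 →
        (W.frobeniusTrace 2 = 2 ∨ W.frobeniusTrace 2 = -2) → MissingUpperBoundAt W 2 := by
  intro W _ _ hcm hr hss ha
  have hL : W.entireLFunction 1 ≠ 0 := entireLFunction_one_ne_zero_of_analyticRank_eq_zero W hPub.1 hr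
  obtain ⟨κ, hκ, γ, hγ, hγ'⟩ := exists_isCyclotomic_isTopGenerator_isCyclotomicVariable_holds 2
  set v : HeightOneSpectrum (𝓞 ℚ) := (Rat.HeightOneSpectrum.primesEquiv (R := 𝓞 ℚ)).symm ⟨2, Nat.prime_two⟩ with hv_def
  have hv : (2 : 𝓞 ℚ) ∈ v.asIdeal := by
    have h := natCast_mem_asIdeal_primesEquiv_symm 2 Nat.prime_two
    simpa [hv_def] using h
  obtain ⟨g, c, -, hEC, hCK, hμ⟩ := hFlat W hcm hr hss ha κ γ hκ hγ hγ' v hv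
  by_cases hsurj : TwoAdicSurjective W
  · exact missingUpperBoundAt_two_of_flatUpper W _ g c hPub.1 hPub.2 hss.1 hss.2 hL hγ hEC
      (flatUpper_two_of_flatColemanKato W _ g c h124 hX0 hss.1 hss.2 hL hκ hγ hsurj hCK)
  · exact missingUpperBoundAt_two_of_flatUpper W _ g c hPub.1 hPub.2 hss.1 hss.2 hL hγ hEC
      (flatUpper_two_of_flatColemanKato_of_mu W _ g c h124 hX0 hss.1 hss.2 hL hκ hγ hCK (hμ hsurj))

/-- **Crux `SupersingularRankZeroAtTwo` BY NAME from the seven v7 stubs of line `signed_halves_two`**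
(`hPub` = `stub_pub` (modularity ∧ GZK) ∧ (Kato 12.4 (2) ∧ Kato 12.4 (1) ∘ (17.13.1)), `hEC` =
`stub_zeroSignedEulerChar`, `hlow` = `stub_zeroKobayashiLower`, `hCK` = `stub_zeroColemanKato` (v6), `hμ` =
`stub_zeroMuPlusOfNonSurj` (v6), `hFlat` = `stub_pmFlatRoad` (NEW: the ∀-closed ♭ road on `a₂ = ±2`), `hML` =
`stub_pmMillerLower` (Miller's LOWER half on `a₂ = ±2`)) — p495102's
`SSColemanRoad.supersingularRankZeroAtTwo_of_line_colemanKatoV6` with the `a₂ = ±2` UPPER half fed by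
`traceTwoUpper_of_flatRoad`. [cite: Kobayashi2003, Thm. 1.2, Thm. 4.1, §7 and Conjecture (p. 2)]
[cite: Sprung2012, Thm. 2.2, Thm. 7.14, 7.16, Prop. 7.19 and Main Conj. 7.21] [cite: Sprung2024, §5.2 Lemmas 5.5–5.9]
[cite: BDKim2013, Cor. 3.15] [cite: Kato2004Asterisque, Thm. 12.4–12.6] [cite: Miller2011LMS, Def. 1.1] -/
theorem supersingularRankZeroAtTwo_of_line_flatRoad
    (hPub : (nonempty_modularParametrizationData ∧ rank_eq_analyticRank_of_analyticRank_le_one) ∧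
      (Kato2004.thm12_4 ∧ Kato2004_fineSelmerDual_isTorsion))
    (hEC : ∀ (W : WeierstrassCurve ℚ) [W.IsElliptic] [W.IsGloballyMinimal],
        ¬ W.HasCM → W.analyticRank = 0 → GoodSS W 2 → W.frobeniusTrace 2 = 0 →
        ∀ (κ : ZpExtension ℚ 2) (γ : Field.absoluteGaloisGroup ℚ),
          κ.IsCyclotomic → κ.IsTopGenerator γ → Finite (W.selmerGroupPInfty 2) →
          Finite (endInvariants (conjSignedSelmerInfty W κ 1 γ - 1)) ∧
            ∃ u : ℤ_[2]ˣ, (Nat.card (endInvariants (conjSignedSelmerInfty W κ 1 γ - 1)) : ℚ_[2]) =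
              ((u : ℤ_[2]) : ℚ_[2]) * ((2 : ℕ) : ℚ_[2]) ^ (padicValNat 2 W.tamagawaProduct) *
                (Nat.card (W.selmerGroupPInfty 2) : ℚ_[2]) *
                  (Nat.card (EndCoinvariants (conjSignedSelmerInfty W κ 1 γ - 1)) : ℚ_[2]))
    (hlow : ∀ (W : WeierstrassCurve ℚ) [W.IsElliptic] [W.IsGloballyMinimal],
      ¬ W.HasCM → W.analyticRank = 0 → GoodSS W 2 → W.frobeniusTrace 2 = 0 →
        KobayashiLowerDivisibility W 2 1)
    (hCK : ∀ (W : WeierstrassCurve ℚ) [W.IsElliptic] [W.IsGloballyMinimal],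
      ¬ W.HasCM → W.analyticRank = 0 → GoodSS W 2 → W.frobeniusTrace 2 = 0 →
      ∀ (κ : ZpExtension ℚ 2) (γ : Field.absoluteGaloisGroup ℚ),
        κ.IsCyclotomic → κ.IsTopGenerator γ → IsCyclotomicVariable 2 γ →
        ∀ [NeZero (W.conductorNorm ℤ)] (f : CuspForm (Gamma0 (W.conductorNorm ℤ)) 2),
          IsNewformOf W f → ∀ (ϖ : ℚ), (ϖ : ℝ) * W.realPeriodRat = plusPeriod f →
        ∀ (Lplus Lminus : IwasawaAlgebra 2), IsPollackPair f 2 Lplus Lminus →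
        ∀ (D : SignedSelmerDualData W κ γ 1) [ContinuousSMul ℤ_[2] (W.tateModule 2)],
          ∃ (I : Kato2004.IwasawaH1Data W 2 κ γ) (Y : W.FineSelmerDualData κ γ)
            (P : Submodule (IwasawaAlgebra 2) (IwasawaAlgebra 2))
            (loc : I.H →ₗ[IwasawaAlgebra 2] P) (toX : P →ₗ[IwasawaAlgebra 2] D.X)
            (δ : D.X →ₗ[IwasawaAlgebra 2] Y.X) (Z : Submodule (IwasawaAlgebra 2) I.H)
            (G : IwasawaAlgebra 2),
            Function.Exact loc toX ∧ Function.Exact toX δ ∧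
            G ∈ Submodule.map (P.subtype ∘ₗ loc) Z ∧
            iwasawaToPowerSeries 2 G =
              PowerSeries.C (ϖ : ℚ_[2]) * iwasawaToPowerSeries 2 (kobayashiL 1 Lplus Lminus) ∧
            (∀ 𝔭 : PrimeSpectrum (IwasawaAlgebra 2), 𝔭.asIdeal.height = 1 →
              PowerSeries.C (2 : ℤ_[2]) ∉ 𝔭.asIdeal →
              Literature.NumberTheory.EllipticCurves.Module.lengthAt (IwasawaAlgebra 2) Y.X 𝔭 ≤
                Literature.NumberTheory.EllipticCurves.Module.lengthAt (IwasawaAlgebra 2) (I.H ⧸ Z) 𝔭) ∧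
            (TwoAdicSurjective W →
              ∀ 𝔭 : PrimeSpectrum (IwasawaAlgebra 2), 𝔭.asIdeal.height = 1 →
                PowerSeries.C (2 : ℤ_[2]) ∈ 𝔭.asIdeal →
                Literature.NumberTheory.EllipticCurves.Module.lengthAt (IwasawaAlgebra 2) Y.X 𝔭 ≤
                  Literature.NumberTheory.EllipticCurves.Module.lengthAt (IwasawaAlgebra 2) (I.H ⧸ Z) 𝔭))
    (hμ : ∀ (W : WeierstrassCurve ℚ) [W.IsElliptic] [W.IsGloballyMinimal],
      ¬ W.HasCM → W.analyticRank = 0 → GoodSS W 2 → W.frobeniusTrace 2 = 0 →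
      ¬ TwoAdicSurjective W →
      ∀ (κ : ZpExtension ℚ 2) (γ : Field.absoluteGaloisGroup ℚ),
        κ.IsCyclotomic → κ.IsTopGenerator γ → IsCyclotomicVariable 2 γ →
        ∀ (D : SignedSelmerDualData W κ γ 1) (g : IwasawaAlgebra 2),
          D.charIdeal = Ideal.span {g} → ¬ PowerSeries.C (2 : ℤ_[2]) ∣ g)
    (hFlat : ∀ (W : WeierstrassCurve ℚ) [W.IsElliptic] [W.IsGloballyMinimal],
      ¬ W.HasCM → W.analyticRank = 0 → GoodSS W 2 → (W.frobeniusTrace 2 = 2 ∨ W.frobeniusTrace 2 = -2) →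
      ∀ (κ : ZpExtension ℚ 2) (γ : Field.absoluteGaloisGroup ℚ),
        κ.IsCyclotomic → κ.IsTopGenerator γ → IsCyclotomicVariable 2 γ →
      ∀ (v : HeightOneSpectrum (𝓞 ℚ)), (2 : 𝓞 ℚ) ∈ v.asIdeal →
      ∃ (g : Field.absoluteGaloisGroup (v.adicCompletion ℚ)) (c : ℕ → localPoints W (v.adicCompletion ℚ)),
        κ.IsTopGenerator (resGalOfEmb (closureEmb (K := ℚ) (v.adicCompletion ℚ)) g) ∧
        (∀ (D : SharpFlatSelmerDualData W κ γ (closureEmb (K := ℚ) (v.adicCompletion ℚ))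
            (W.frobeniusTrace 2) g c .flat) [Module.Finite (IwasawaAlgebra 2) D.X],
          Module.IsTorsion (IwasawaAlgebra 2) D.X →
          ∀ f : IwasawaAlgebra 2, D.charIdeal = Ideal.span {f} → Finite (W.selmerGroupPInfty 2) →
            ∃ u : ℤ_[2]ˣ, ((PowerSeries.constantCoeff f : ℤ_[2]) : ℚ_[2]) =
              ((u : ℤ_[2]) : ℚ_[2]) * ((2 : ℕ) : ℚ_[2]) ^ (padicValNat 2 W.tamagawaProduct) *
                (Nat.card (W.selmerGroupPInfty 2) : ℚ_[2])) ∧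
        (∀ [NeZero (W.conductorNorm ℤ)] (f : CuspForm (Gamma0 (W.conductorNorm ℤ)) 2),
            IsNewformOf W f → ∀ (ϖ : ℚ), (ϖ : ℝ) * W.realPeriodRat = plusPeriod f →
          ∀ (Ls Lf : IwasawaAlgebra 2), IsSprungPair f 2 (W.frobeniusTrace 2) Ls Lf →
          ∀ (D : SharpFlatSelmerDualData W κ γ (closureEmb (K := ℚ) (v.adicCompletion ℚ))
              (W.frobeniusTrace 2) g c .flat) [ContinuousSMul ℤ_[2] (W.tateModule 2)],
            ∃ (I : Kato2004.IwasawaH1Data W 2 κ γ) (Y : W.FineSelmerDualData κ γ)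
              (P : Submodule (IwasawaAlgebra 2) (IwasawaAlgebra 2))
              (loc : I.H →ₗ[IwasawaAlgebra 2] P) (toX : P →ₗ[IwasawaAlgebra 2] D.X)
              (δ : D.X →ₗ[IwasawaAlgebra 2] Y.X) (Z : Submodule (IwasawaAlgebra 2) I.H)
              (G : IwasawaAlgebra 2),
              Function.Exact loc toX ∧ Function.Exact toX δ ∧
              G ∈ Submodule.map (P.subtype ∘ₗ loc) Z ∧
              iwasawaToPowerSeries 2 G = PowerSeries.C (ϖ : ℚ_[2]) * iwasawaToPowerSeries 2 Lf ∧
              (∀ 𝔭 : PrimeSpectrum (IwasawaAlgebra 2), 𝔭.asIdeal.height = 1 →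
                PowerSeries.C (2 : ℤ_[2]) ∉ 𝔭.asIdeal →
                Literature.NumberTheory.EllipticCurves.Module.lengthAt (IwasawaAlgebra 2) Y.X 𝔭 ≤
                  Literature.NumberTheory.EllipticCurves.Module.lengthAt (IwasawaAlgebra 2) (I.H ⧸ Z) 𝔭) ∧
              (TwoAdicSurjective W →
                ∀ 𝔭 : PrimeSpectrum (IwasawaAlgebra 2), 𝔭.asIdeal.height = 1 →
                  PowerSeries.C (2 : ℤ_[2]) ∈ 𝔭.asIdeal →
                  Literature.NumberTheory.EllipticCurves.Module.lengthAt (IwasawaAlgebra 2) Y.X 𝔭 ≤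
                    Literature.NumberTheory.EllipticCurves.Module.lengthAt (IwasawaAlgebra 2) (I.H ⧸ Z) 𝔭)) ∧
        (¬ TwoAdicSurjective W →
          ∀ (D : SharpFlatSelmerDualData W κ γ (closureEmb (K := ℚ) (v.adicCompletion ℚ))
              (W.frobeniusTrace 2) g c .flat) (g' : IwasawaAlgebra 2),
            D.charIdeal = Ideal.span {g'} → ¬ PowerSeries.C (2 : ℤ_[2]) ∣ g'))
    (hML : ∀ (W : WeierstrassCurve ℚ) [W.IsElliptic] [W.IsGloballyMinimal],
        ¬ W.HasCM → W.analyticRank = 0 → GoodSS W 2 →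
          (W.frobeniusTrace 2 = 2 ∨ W.frobeniusTrace 2 = -2) → MissingLowerBoundAt W 2) :
    Summit.BirchSwinnertonDyer.BirchSwinnertonDyer.Theses.ByReductionTypeAtTwo.SupersingularRankZeroAtTwo :=
  SSColemanRoad.supersingularRankZeroAtTwo_of_line_colemanKatoV6 hPub.1 hPub.2 hEC hlow hCK hμ
    ⟨hML, traceTwoUpper_of_flatRoad hPub.1 hPub.2.1 hPub.2.2 hFlat⟩

end SSFlatRoad
end Summit.BirchSwinnertonDyer.BirchSwinnertonDyer.Theorems

end
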